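import Mathlib.Analysis.Fourier.FiniteAbelian.PontryaginDuality
import Mathlib.Tactic.Linarith
import Mathlib.Tactic.LinearCombination
import Mathlib.Tactic.Ring
import Mathlib.Tactic.Abel
import Summits.MatrixMultiplication.OmegaCensus.DihedralLikeTiling
import HarnessLib

/-!
# Odd characters and the near-tiling obstruction for dicyclic-like groups

ω-census, family (b3).  Framing: lottery ticket; floor = certified bounds/negative ranges.

Let `A` be a finite abelian group and `c₀ ∈ A` with `2c₀ = 0 ≠ c₀`.  A character `ψ` of `A` is *odd* if
`ψ c₀ = −1`.  Elementary facts: a `c₀`-periodic set has vanishing character sum at every odd character, and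
conversely (`periodic_of_charsum_eq_zero`, Fourier inversion); a periodic set minus one point `d` has character sum
`−ψ d ≠ 0` at odd `ψ`; two non-empty periodic sets never sit inside an injective triple sumset.

**Theorem (`near_tiling_contradiction`).** Let `S₀,S₁,T₀,T₁,U₀,U₁ ⊆ A` be non-empty with all eight sumsets
`S_i+T_j+U_k` injective, and suppose that in each of the two triangles `{S₁+T₀+U₀, S₀+T₁+U₀, S₀+T₀+U₁}`,
`{S₀+T₁+U₁, S₁+T₀+U₁, S₁+T₁+U₀}` every part is `c₀`-periodic except possibly one, which is a periodic set minus a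
point, and that not all six parts are periodic.  Then: contradiction.  (At an odd character the periodic parts give
vanishing products `Ŝ_i T̂_j Û_k = 0` and the punctured one a non-vanishing product; in each of the 15 cases this
forces two of the six sets with different letters to be periodic, contradicting injectivity.)  This is the Fourier
half of `β(Q_{4n}) = 8⌊2n/3⌋` for `n ≡ 1 (mod 3)` (`DicyclicLawModOne.lean`).
-/

namespace Summit.MatrixMultiplication.OmegaCensus

open Literature.Combinatorics.Additive Finset

section OddCharacters

variable {A : Type*} [AddCommGroup A] [Fintype A] [DecidableEq A] {c₀ : A}

omit [Fintype A] [DecidableEq A] in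
/-- When `2c₀ = 0`, every character takes the value `±1` at `c₀`. [folklore] -/
theorem addChar_shift_eq (h2 : c₀ + c₀ = 0) (ψ : AddChar A ℂ) : ψ c₀ = 1 ∨ ψ c₀ = -1 := by
  apply mul_self_eq_one_iff.1
  rw [← AddChar.map_add_eq_mul, h2, AddChar.map_zero_eq_one]

omit [Fintype A] [DecidableEq A] in
/-- When `2c₀ = 0`, `−c₀ = c₀`. [folklore] -/
theorem neg_shift (h2 : c₀ + c₀ = 0) : -c₀ = c₀ :=
  neg_eq_iff_add_eq_zero.2 h2

omit [Fintype A] [DecidableEq A] in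
/-- Characters never vanish. [folklore] -/
theorem addChar_ne_zero (ψ : AddChar A ℂ) (a : A) : ψ a ≠ 0 := by
  intro h
  have := AddChar.map_add_eq_mul ψ a (-a)
  rw [add_neg_cancel, AddChar.map_zero_eq_one, h, zero_mul] at this
  exact one_ne_zero this

omit [Fintype A] in
/-- The character sum of a translate. [folklore] -/
theorem charsum_shift (ψ : AddChar A ℂ) (X : Finset A) :
    ∑ x ∈ X.image (fun x => x + c₀), ψ x = (∑ x ∈ X, ψ x) * ψ c₀ := by
  rw [sum_image fun x _ y _ h => add_right_cancel h, sum_mul]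
  exact sum_congr rfl fun x _ => AddChar.map_add_eq_mul ψ x c₀

omit [Fintype A] in
/-- A `c₀`-periodic set has vanishing character sum at every odd character. [folklore] -/
theorem charsum_eq_zero_of_periodic {X : Finset A} (hX : X.image (fun x => x + c₀) = X)
    {ψ : AddChar A ℂ} (hψ : ψ c₀ = -1) : ∑ x ∈ X, ψ x = 0 := by
  have h := charsum_shift (c₀ := c₀) ψ X
  rw [hX, hψ] at h
  have h2 : (∑ x ∈ X, ψ x) * 2 = 0 := by linear_combination h
  exact (mul_eq_zero.1 h2).resolve_right two_ne_zero

omit [Fintype A] in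
/-- A periodic set minus one point `d` has character sum `−ψ d` at every odd character. [folklore] -/
theorem charsum_eq_neg_of_near {X : Finset A} {d : A} (hd : d ∉ X)
    (hX : (insert d X).image (fun x => x + c₀) = insert d X) {ψ : AddChar A ℂ} (hψ : ψ c₀ = -1) :
    ∑ x ∈ X, ψ x = -ψ d := by
  have h := charsum_eq_zero_of_periodic hX hψ
  rw [sum_insert hd] at h
  linear_combination h

/-- **Fourier inversion at odd characters**: a set whose character sums vanish at all odd characters is
`c₀`-periodic (`2c₀ = 0`). [folklore] -/
theorem periodic_of_charsum_eq_zero (h2 : c₀ + c₀ = 0) {X : Finset A}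
    (hX : ∀ ψ : AddChar A ℂ, ψ c₀ = -1 → ∑ x ∈ X, ψ x = 0) : X.image (fun x => x + c₀) = X := by
  have ind : ∀ y : A, ∑ ψ : AddChar A ℂ, (∑ x ∈ X, ψ x) * ψ (-y) =
      if y ∈ X then (Fintype.card A : ℂ) else 0 := by
    intro y
    have step : ∀ ψ : AddChar A ℂ, (∑ x ∈ X, ψ x) * ψ (-y) = ∑ x ∈ X, ψ (x + -y) := by
      intro ψ
      rw [sum_mul]
      exact sum_congr rfl fun x _ => (AddChar.map_add_eq_mul ψ x (-y)).symm
    simp_rw [step]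
    rw [sum_comm]
    simp_rw [AddChar.sum_apply_eq_ite, add_neg_eq_zero]
    rw [sum_ite_eq']
  have shift : ∀ y : A, (if y + c₀ ∈ X then (Fintype.card A : ℂ) else 0) =
      if y ∈ X then (Fintype.card A : ℂ) else 0 := by
    intro y
    rw [← ind, ← ind]
    refine sum_congr rfl fun ψ _ => ?_
    rcases addChar_shift_eq h2 ψ with h | h
    · rw [neg_add, AddChar.map_add_eq_mul, neg_shift h2, h, mul_one]
    · rw [hX ψ h, zero_mul, zero_mul]
  have mem : ∀ y ∈ X, y + c₀ ∈ X := by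
    intro y hy
    have h := shift y
    rw [if_pos hy] at h
    by_contra hc
    rw [if_neg hc] at h
    exact Nat.cast_ne_zero.2 Fintype.card_ne_zero h.symm
  apply eq_of_subset_of_card_le
  · intro z hz
    obtain ⟨y, hy, rfl⟩ := mem_image.1 hz
    exact mem y hy
  · rw [card_image_of_injective _ (add_left_injective c₀)]

omit [Fintype A] in
/-- Two non-empty periodic sets in slots 1, 2 of a triple sumset with non-empty third slot destroy injectivity
(`c₀ ≠ 0`). [folklore] -/
theorem not_injOn_of_periodic₁₂ (hc : c₀ ≠ 0) {P Q R : Finset A}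
    (hP : P.image (fun x => x + c₀) = P) (hQ : Q.image (fun x => x + c₀) = Q)
    (hPn : P.Nonempty) (hQn : Q.Nonempty) (hRn : R.Nonempty) :
    ¬ Set.InjOn (fun p : A × A × A => p.1 + p.2.1 + p.2.2) ↑(P ×ˢ Q ×ˢ R) := by
  obtain ⟨⟨p, hp⟩, ⟨q, hq⟩, ⟨r, hr⟩⟩ := And.intro hPn (And.intro hQn hRn)
  have hp' : p + c₀ ∈ P := by rw [← hP]; exact mem_image_of_mem _ hp
  have hq' : q + c₀ ∈ Q := by rw [← hQ]; exact mem_image_of_mem _ hq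
  intro hinj
  have h1 : ((p + c₀, q, r) : A × A × A) ∈ (↑(P ×ˢ Q ×ˢ R) : Set (A × A × A)) := by
    simp [hp', hq, hr]
  have h2 : ((p, q + c₀, r) : A × A × A) ∈ (↑(P ×ˢ Q ×ˢ R) : Set (A × A × A)) := by
    simp [hp, hq', hr]
  have h := hinj h1 h2 (by simp only; abel)
  simp only [Prod.mk.injEq] at h
  exact hc (by simpa using h.1)

omit [Fintype A] in
/-- Two non-empty periodic sets in slots 1, 3. [folklore] -/
theorem not_injOn_of_periodic₁₃ (hc : c₀ ≠ 0) {P Q R : Finset A}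
    (hP : P.image (fun x => x + c₀) = P) (hR : R.image (fun x => x + c₀) = R)
    (hPn : P.Nonempty) (hQn : Q.Nonempty) (hRn : R.Nonempty) :
    ¬ Set.InjOn (fun p : A × A × A => p.1 + p.2.1 + p.2.2) ↑(P ×ˢ Q ×ˢ R) := by
  obtain ⟨⟨p, hp⟩, ⟨q, hq⟩, ⟨r, hr⟩⟩ := And.intro hPn (And.intro hQn hRn)
  have hp' : p + c₀ ∈ P := by rw [← hP]; exact mem_image_of_mem _ hp
  have hr' : r + c₀ ∈ R := by rw [← hR]; exact mem_image_of_mem _ hr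
  intro hinj
  have h1 : ((p + c₀, q, r) : A × A × A) ∈ (↑(P ×ˢ Q ×ˢ R) : Set (A × A × A)) := by
    simp [hp', hq, hr]
  have h2 : ((p, q, r + c₀) : A × A × A) ∈ (↑(P ×ˢ Q ×ˢ R) : Set (A × A × A)) := by
    simp [hp, hq, hr']
  have h := hinj h1 h2 (by simp only; abel)
  simp only [Prod.mk.injEq] at h
  exact hc (by simpa using h.1)

omit [Fintype A] in
/-- Two non-empty periodic sets in slots 2, 3. [folklore] -/
theorem not_injOn_of_periodic₂₃ (hc : c₀ ≠ 0) {P Q R : Finset A}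
    (hQ : Q.image (fun x => x + c₀) = Q) (hR : R.image (fun x => x + c₀) = R)
    (hPn : P.Nonempty) (hQn : Q.Nonempty) (hRn : R.Nonempty) :
    ¬ Set.InjOn (fun p : A × A × A => p.1 + p.2.1 + p.2.2) ↑(P ×ˢ Q ×ˢ R) := by
  obtain ⟨⟨p, hp⟩, ⟨q, hq⟩, ⟨r, hr⟩⟩ := And.intro hPn (And.intro hQn hRn)
  have hq' : q + c₀ ∈ Q := by rw [← hQ]; exact mem_image_of_mem _ hq
  have hr' : r + c₀ ∈ R := by rw [← hR]; exact mem_image_of_mem _ hr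
  intro hinj
  have h1 : ((p, q + c₀, r) : A × A × A) ∈ (↑(P ×ˢ Q ×ˢ R) : Set (A × A × A)) := by
    simp [hp, hq', hr]
  have h2 : ((p, q, r + c₀) : A × A × A) ∈ (↑(P ×ˢ Q ×ˢ R) : Set (A × A × A)) := by
    simp [hp, hq, hr']
  have h := hinj h1 h2 (by simp only; abel)
  simp only [Prod.mk.injEq] at h
  exact hc (by simpa using h.2.1)

omit [Fintype A] [DecidableEq A] in
/-- `abc ≠ 0` unpacks. [folklore] -/
theorem ne_zero_three {a b c : ℂ} (h : a * b * c ≠ 0) : a ≠ 0 ∧ b ≠ 0 ∧ c ≠ 0 := by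
  obtain ⟨hab, hc⟩ := mul_ne_zero_iff.1 h
  obtain ⟨ha, hb⟩ := mul_ne_zero_iff.1 hab
  exact ⟨ha, hb, hc⟩

omit [Fintype A] [DecidableEq A] in
/-- `abc = 0`, `b, c ≠ 0` gives `a = 0`. [folklore] -/
theorem zero_of_mul₁ {a b c : ℂ} (h : a * b * c = 0) (hb : b ≠ 0) (hc : c ≠ 0) : a = 0 := by
  rcases mul_eq_zero.1 h with h | h
  · exact (mul_eq_zero.1 h).resolve_right hb
  · exact absurd h hc

omit [Fintype A] [DecidableEq A] in
/-- `abc = 0`, `a, c ≠ 0` gives `b = 0`. [folklore] -/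
theorem zero_of_mul₂ {a b c : ℂ} (h : a * b * c = 0) (ha : a ≠ 0) (hc : c ≠ 0) : b = 0 := by
  rcases mul_eq_zero.1 h with h | h
  · exact (mul_eq_zero.1 h).resolve_left ha
  · exact absurd h hc

omit [Fintype A] [DecidableEq A] in
/-- `abc = 0`, `a, b ≠ 0` gives `c = 0`. [folklore] -/
theorem zero_of_mul₃ {a b c : ℂ} (h : a * b * c = 0) (ha : a ≠ 0) (hb : b ≠ 0) : c = 0 := by
  rcases mul_eq_zero.1 h with h | h
  · exact absurd h (mul_ne_zero ha hb)
  · exact h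

/-- **The near-tiling obstruction.** See the file header: six non-empty sets, eight injective sumsets, in each
triangle all parts `c₀`-periodic except at most one punctured-periodic part, not all six periodic ⇒ `False`
(`2c₀ = 0 ≠ c₀`). [folklore] -/
theorem near_tiling_contradiction (h2 : c₀ + c₀ = 0) (hc : c₀ ≠ 0) {S₀ S₁ T₀ T₁ U₀ U₁ : Finset A}
    (hS₀ : S₀.Nonempty) (hS₁ : S₁.Nonempty) (hT₀ : T₀.Nonempty) (hT₁ : T₁.Nonempty)
    (hU₀ : U₀.Nonempty) (hU₁ : U₁.Nonempty)
    (i000 : Set.InjOn (fun p : A × A × A => p.1 + p.2.1 + p.2.2) ↑(S₀ ×ˢ T₀ ×ˢ U₀))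
    (i001 : Set.InjOn (fun p : A × A × A => p.1 + p.2.1 + p.2.2) ↑(S₀ ×ˢ T₀ ×ˢ U₁))
    (i010 : Set.InjOn (fun p : A × A × A => p.1 + p.2.1 + p.2.2) ↑(S₀ ×ˢ T₁ ×ˢ U₀))
    (i011 : Set.InjOn (fun p : A × A × A => p.1 + p.2.1 + p.2.2) ↑(S₀ ×ˢ T₁ ×ˢ U₁))
    (i100 : Set.InjOn (fun p : A × A × A => p.1 + p.2.1 + p.2.2) ↑(S₁ ×ˢ T₀ ×ˢ U₀))
    (i101 : Set.InjOn (fun p : A × A × A => p.1 + p.2.1 + p.2.2) ↑(S₁ ×ˢ T₀ ×ˢ U₁))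
    (i110 : Set.InjOn (fun p : A × A × A => p.1 + p.2.1 + p.2.2) ↑(S₁ ×ˢ T₁ ×ˢ U₀))
    (i111 : Set.InjOn (fun p : A × A × A => p.1 + p.2.1 + p.2.2) ↑(S₁ ×ˢ T₁ ×ˢ U₁))
    (h1 : (((((S₁ ×ˢ T₀ ×ˢ U₀).image fun p : A × A × A => p.1 + p.2.1 + p.2.2)).image (fun x => x + c₀) = (((S₁ ×ˢ T₀ ×ˢ U₀).image fun p : A × A × A => p.1 + p.2.1 + p.2.2))) ∧ ((((S₀ ×ˢ T₁ ×ˢ U₀).image fun p : A × A × A => p.1 + p.2.1 + p.2.2)).image (fun x => x + c₀) = (((S₀ ×ˢ T₁ ×ˢ U₀).image fun p : A × A × A => p.1 + p.2.1 + p.2.2))) ∧ ((((S₀ ×ˢ T₀ ×ˢ U₁).image fun p : A × A × A => p.1 + p.2.1 + p.2.2)).image (fun x => x + c₀) = (((S₀ ×ˢ T₀ ×ˢ U₁).image fun p : A × A × A => p.1 + p.2.1 + p.2.2)))) ∨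
      ((∃ d, d ∉ (((S₁ ×ˢ T₀ ×ˢ U₀).image fun p : A × A × A => p.1 + p.2.1 + p.2.2)) ∧ (insert d (((S₁ ×ˢ T₀ ×ˢ U₀).image fun p : A × A × A => p.1 + p.2.1 + p.2.2))).image (fun x => x + c₀) = insert d (((S₁ ×ˢ T₀ ×ˢ U₀).image fun p : A × A × A => p.1 + p.2.1 + p.2.2))) ∧ ((((S₀ ×ˢ T₁ ×ˢ U₀).image fun p : A × A × A => p.1 + p.2.1 + p.2.2)).image (fun x => x + c₀) = (((S₀ ×ˢ T₁ ×ˢ U₀).image fun p : A × A × A => p.1 + p.2.1 + p.2.2))) ∧ ((((S₀ ×ˢ T₀ ×ˢ U₁).image fun p : A × A × A => p.1 + p.2.1 + p.2.2)).image (fun x => x + c₀) = (((S₀ ×ˢ T₀ ×ˢ U₁).image fun p : A × A × A => p.1 + p.2.1 + p.2.2)))) ∨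
      (((((S₁ ×ˢ T₀ ×ˢ U₀).image fun p : A × A × A => p.1 + p.2.1 + p.2.2)).image (fun x => x + c₀) = (((S₁ ×ˢ T₀ ×ˢ U₀).image fun p : A × A × A => p.1 + p.2.1 + p.2.2))) ∧ (∃ d, d ∉ (((S₀ ×ˢ T₁ ×ˢ U₀).image fun p : A × A × A => p.1 + p.2.1 + p.2.2)) ∧ (insert d (((S₀ ×ˢ T₁ ×ˢ U₀).image fun p : A × A × A => p.1 + p.2.1 + p.2.2))).image (fun x => x + c₀) = insert d (((S₀ ×ˢ T₁ ×ˢ U₀).image fun p : A × A × A => p.1 + p.2.1 + p.2.2))) ∧ ((((S₀ ×ˢ T₀ ×ˢ U₁).image fun p : A × A × A => p.1 + p.2.1 + p.2.2)).image (fun x => x + c₀) = (((S₀ ×ˢ T₀ ×ˢ U₁).image fun p : A × A × A => p.1 + p.2.1 + p.2.2)))) ∨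
      (((((S₁ ×ˢ T₀ ×ˢ U₀).image fun p : A × A × A => p.1 + p.2.1 + p.2.2)).image (fun x => x + c₀) = (((S₁ ×ˢ T₀ ×ˢ U₀).image fun p : A × A × A => p.1 + p.2.1 + p.2.2))) ∧ ((((S₀ ×ˢ T₁ ×ˢ U₀).image fun p : A × A × A => p.1 + p.2.1 + p.2.2)).image (fun x => x + c₀) = (((S₀ ×ˢ T₁ ×ˢ U₀).image fun p : A × A × A => p.1 + p.2.1 + p.2.2))) ∧ (∃ d, d ∉ (((S₀ ×ˢ T₀ ×ˢ U₁).image fun p : A × A × A => p.1 + p.2.1 + p.2.2)) ∧ (insert d (((S₀ ×ˢ T₀ ×ˢ U₁).image fun p : A × A × A => p.1 + p.2.1 + p.2.2))).image (fun x => x + c₀) = insert d (((S₀ ×ˢ T₀ ×ˢ U₁).image fun p : A × A × A => p.1 + p.2.1 + p.2.2)))))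
    (h3 : (((((S₀ ×ˢ T₁ ×ˢ U₁).image fun p : A × A × A => p.1 + p.2.1 + p.2.2)).image (fun x => x + c₀) = (((S₀ ×ˢ T₁ ×ˢ U₁).image fun p : A × A × A => p.1 + p.2.1 + p.2.2))) ∧ ((((S₁ ×ˢ T₀ ×ˢ U₁).image fun p : A × A × A => p.1 + p.2.1 + p.2.2)).image (fun x => x + c₀) = (((S₁ ×ˢ T₀ ×ˢ U₁).image fun p : A × A × A => p.1 + p.2.1 + p.2.2))) ∧ ((((S₁ ×ˢ T₁ ×ˢ U₀).image fun p : A × A × A => p.1 + p.2.1 + p.2.2)).image (fun x => x + c₀) = (((S₁ ×ˢ T₁ ×ˢ U₀).image fun p : A × A × A => p.1 + p.2.1 + p.2.2)))) ∨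
      ((∃ d, d ∉ (((S₀ ×ˢ T₁ ×ˢ U₁).image fun p : A × A × A => p.1 + p.2.1 + p.2.2)) ∧ (insert d (((S₀ ×ˢ T₁ ×ˢ U₁).image fun p : A × A × A => p.1 + p.2.1 + p.2.2))).image (fun x => x + c₀) = insert d (((S₀ ×ˢ T₁ ×ˢ U₁).image fun p : A × A × A => p.1 + p.2.1 + p.2.2))) ∧ ((((S₁ ×ˢ T₀ ×ˢ U₁).image fun p : A × A × A => p.1 + p.2.1 + p.2.2)).image (fun x => x + c₀) = (((S₁ ×ˢ T₀ ×ˢ U₁).image fun p : A × A × A => p.1 + p.2.1 + p.2.2))) ∧ ((((S₁ ×ˢ T₁ ×ˢ U₀).image fun p : A × A × A => p.1 + p.2.1 + p.2.2)).image (fun x => x + c₀) = (((S₁ ×ˢ T₁ ×ˢ U₀).image fun p : A × A × A => p.1 + p.2.1 + p.2.2)))) ∨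
      (((((S₀ ×ˢ T₁ ×ˢ U₁).image fun p : A × A × A => p.1 + p.2.1 + p.2.2)).image (fun x => x + c₀) = (((S₀ ×ˢ T₁ ×ˢ U₁).image fun p : A × A × A => p.1 + p.2.1 + p.2.2))) ∧ (∃ d, d ∉ (((S₁ ×ˢ T₀ ×ˢ U₁).image fun p : A × A × A => p.1 + p.2.1 + p.2.2)) ∧ (insert d (((S₁ ×ˢ T₀ ×ˢ U₁).image fun p : A × A × A => p.1 + p.2.1 + p.2.2))).image (fun x => x + c₀) = insert d (((S₁ ×ˢ T₀ ×ˢ U₁).image fun p : A × A × A => p.1 + p.2.1 + p.2.2))) ∧ ((((S₁ ×ˢ T₁ ×ˢ U₀).image fun p : A × A × A => p.1 + p.2.1 + p.2.2)).image (fun x => x + c₀) = (((S₁ ×ˢ T₁ ×ˢ U₀).image fun p : A × A × A => p.1 + p.2.1 + p.2.2)))) ∨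
      (((((S₀ ×ˢ T₁ ×ˢ U₁).image fun p : A × A × A => p.1 + p.2.1 + p.2.2)).image (fun x => x + c₀) = (((S₀ ×ˢ T₁ ×ˢ U₁).image fun p : A × A × A => p.1 + p.2.1 + p.2.2))) ∧ ((((S₁ ×ˢ T₀ ×ˢ U₁).image fun p : A × A × A => p.1 + p.2.1 + p.2.2)).image (fun x => x + c₀) = (((S₁ ×ˢ T₀ ×ˢ U₁).image fun p : A × A × A => p.1 + p.2.1 + p.2.2))) ∧ (∃ d, d ∉ (((S₁ ×ˢ T₁ ×ˢ U₀).image fun p : A × A × A => p.1 + p.2.1 + p.2.2)) ∧ (insert d (((S₁ ×ˢ T₁ ×ˢ U₀).image fun p : A × A × A => p.1 + p.2.1 + p.2.2))).image (fun x => x + c₀) = insert d (((S₁ ×ˢ T₁ ×ˢ U₀).image fun p : A × A × A => p.1 + p.2.1 + p.2.2)))))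
    (hnot : ¬ (((((S₁ ×ˢ T₀ ×ˢ U₀).image fun p : A × A × A => p.1 + p.2.1 + p.2.2)).image (fun x => x + c₀) = (((S₁ ×ˢ T₀ ×ˢ U₀).image fun p : A × A × A => p.1 + p.2.1 + p.2.2))) ∧ ((((S₀ ×ˢ T₁ ×ˢ U₀).image fun p : A × A × A => p.1 + p.2.1 + p.2.2)).image (fun x => x + c₀) = (((S₀ ×ˢ T₁ ×ˢ U₀).image fun p : A × A × A => p.1 + p.2.1 + p.2.2))) ∧ ((((S₀ ×ˢ T₀ ×ˢ U₁).image fun p : A × A × A => p.1 + p.2.1 + p.2.2)).image (fun x => x + c₀) = (((S₀ ×ˢ T₀ ×ˢ U₁).image fun p : A × A × A => p.1 + p.2.1 + p.2.2))) ∧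
      ((((S₀ ×ˢ T₁ ×ˢ U₁).image fun p : A × A × A => p.1 + p.2.1 + p.2.2)).image (fun x => x + c₀) = (((S₀ ×ˢ T₁ ×ˢ U₁).image fun p : A × A × A => p.1 + p.2.1 + p.2.2))) ∧ ((((S₁ ×ˢ T₀ ×ˢ U₁).image fun p : A × A × A => p.1 + p.2.1 + p.2.2)).image (fun x => x + c₀) = (((S₁ ×ˢ T₀ ×ˢ U₁).image fun p : A × A × A => p.1 + p.2.1 + p.2.2))) ∧ ((((S₁ ×ˢ T₁ ×ˢ U₀).image fun p : A × A × A => p.1 + p.2.1 + p.2.2)).image (fun x => x + c₀) = (((S₁ ×ˢ T₁ ×ˢ U₀).image fun p : A × A × A => p.1 + p.2.1 + p.2.2))))) : False := by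
  -- the six character sums as functions of `ψ`
  obtain ⟨a₀, ha₀⟩ : ∃ f : AddChar A ℂ → ℂ, ∀ ψ, f ψ = ∑ x ∈ S₀, ψ x := ⟨_, fun _ => rfl⟩
  obtain ⟨a₁, ha₁⟩ : ∃ f : AddChar A ℂ → ℂ, ∀ ψ, f ψ = ∑ x ∈ S₁, ψ x := ⟨_, fun _ => rfl⟩
  obtain ⟨b₀, hb₀⟩ : ∃ f : AddChar A ℂ → ℂ, ∀ ψ, f ψ = ∑ x ∈ T₀, ψ x := ⟨_, fun _ => rfl⟩
  obtain ⟨b₁, hb₁⟩ : ∃ f : AddChar A ℂ → ℂ, ∀ ψ, f ψ = ∑ x ∈ T₁, ψ x := ⟨_, fun _ => rfl⟩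
  obtain ⟨u₀, hu₀⟩ : ∃ f : AddChar A ℂ → ℂ, ∀ ψ, f ψ = ∑ x ∈ U₀, ψ x := ⟨_, fun _ => rfl⟩
  obtain ⟨u₁, hu₁⟩ : ∃ f : AddChar A ℂ → ℂ, ∀ ψ, f ψ = ∑ x ∈ U₁, ψ x := ⟨_, fun _ => rfl⟩
  -- periodic part ⇒ vanishing product, punctured part ⇒ non-vanishing product (odd `ψ`)
  have F100 := fun (hp : ((S₁ ×ˢ T₀ ×ˢ U₀).image fun p : A × A × A => p.1 + p.2.1 + p.2.2).image
      (fun x => x + c₀) = (S₁ ×ˢ T₀ ×ˢ U₀).image fun p : A × A × A => p.1 + p.2.1 + p.2.2)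
      (ψ : AddChar A ℂ) (hψ : ψ c₀ = -1) =>
    show a₁ ψ * b₀ ψ * u₀ ψ = 0 by
      rw [ha₁, hb₀, hu₀, ← charsum_sumset' ψ i100]; exact charsum_eq_zero_of_periodic hp hψ
  have F010 := fun (hp : ((S₀ ×ˢ T₁ ×ˢ U₀).image fun p : A × A × A => p.1 + p.2.1 + p.2.2).image
      (fun x => x + c₀) = (S₀ ×ˢ T₁ ×ˢ U₀).image fun p : A × A × A => p.1 + p.2.1 + p.2.2)
      (ψ : AddChar A ℂ) (hψ : ψ c₀ = -1) =>
    show a₀ ψ * b₁ ψ * u₀ ψ = 0 by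
      rw [ha₀, hb₁, hu₀, ← charsum_sumset' ψ i010]; exact charsum_eq_zero_of_periodic hp hψ
  have F001 := fun (hp : ((S₀ ×ˢ T₀ ×ˢ U₁).image fun p : A × A × A => p.1 + p.2.1 + p.2.2).image
      (fun x => x + c₀) = (S₀ ×ˢ T₀ ×ˢ U₁).image fun p : A × A × A => p.1 + p.2.1 + p.2.2)
      (ψ : AddChar A ℂ) (hψ : ψ c₀ = -1) =>
    show a₀ ψ * b₀ ψ * u₁ ψ = 0 by
      rw [ha₀, hb₀, hu₁, ← charsum_sumset' ψ i001]; exact charsum_eq_zero_of_periodic hp hψ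
  have F011 := fun (hp : ((S₀ ×ˢ T₁ ×ˢ U₁).image fun p : A × A × A => p.1 + p.2.1 + p.2.2).image
      (fun x => x + c₀) = (S₀ ×ˢ T₁ ×ˢ U₁).image fun p : A × A × A => p.1 + p.2.1 + p.2.2)
      (ψ : AddChar A ℂ) (hψ : ψ c₀ = -1) =>
    show a₀ ψ * b₁ ψ * u₁ ψ = 0 by
      rw [ha₀, hb₁, hu₁, ← charsum_sumset' ψ i011]; exact charsum_eq_zero_of_periodic hp hψ
  have F101 := fun (hp : ((S₁ ×ˢ T₀ ×ˢ U₁).image fun p : A × A × A => p.1 + p.2.1 + p.2.2).image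
      (fun x => x + c₀) = (S₁ ×ˢ T₀ ×ˢ U₁).image fun p : A × A × A => p.1 + p.2.1 + p.2.2)
      (ψ : AddChar A ℂ) (hψ : ψ c₀ = -1) =>
    show a₁ ψ * b₀ ψ * u₁ ψ = 0 by
      rw [ha₁, hb₀, hu₁, ← charsum_sumset' ψ i101]; exact charsum_eq_zero_of_periodic hp hψ
  have F110 := fun (hp : ((S₁ ×ˢ T₁ ×ˢ U₀).image fun p : A × A × A => p.1 + p.2.1 + p.2.2).image
      (fun x => x + c₀) = (S₁ ×ˢ T₁ ×ˢ U₀).image fun p : A × A × A => p.1 + p.2.1 + p.2.2)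
      (ψ : AddChar A ℂ) (hψ : ψ c₀ = -1) =>
    show a₁ ψ * b₁ ψ * u₀ ψ = 0 by
      rw [ha₁, hb₁, hu₀, ← charsum_sumset' ψ i110]; exact charsum_eq_zero_of_periodic hp hψ
  have N100 := fun (hp : ∃ d, d ∉ ((S₁ ×ˢ T₀ ×ˢ U₀).image fun p : A × A × A => p.1 + p.2.1 + p.2.2) ∧
      (insert d ((S₁ ×ˢ T₀ ×ˢ U₀).image fun p : A × A × A => p.1 + p.2.1 + p.2.2)).image (fun x => x + c₀) =
        insert d ((S₁ ×ˢ T₀ ×ˢ U₀).image fun p : A × A × A => p.1 + p.2.1 + p.2.2))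
      (ψ : AddChar A ℂ) (hψ : ψ c₀ = -1) =>
    show a₁ ψ ≠ 0 ∧ b₀ ψ ≠ 0 ∧ u₀ ψ ≠ 0 by
      obtain ⟨d, hd, hp⟩ := hp
      apply ne_zero_three
      rw [ha₁, hb₀, hu₀, ← charsum_sumset' ψ i100, charsum_eq_neg_of_near hd hp hψ]
      exact neg_ne_zero.2 (addChar_ne_zero ψ d)
  have N010 := fun (hp : ∃ d, d ∉ ((S₀ ×ˢ T₁ ×ˢ U₀).image fun p : A × A × A => p.1 + p.2.1 + p.2.2) ∧
      (insert d ((S₀ ×ˢ T₁ ×ˢ U₀).image fun p : A × A × A => p.1 + p.2.1 + p.2.2)).image (fun x => x + c₀) =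
        insert d ((S₀ ×ˢ T₁ ×ˢ U₀).image fun p : A × A × A => p.1 + p.2.1 + p.2.2))
      (ψ : AddChar A ℂ) (hψ : ψ c₀ = -1) =>
    show a₀ ψ ≠ 0 ∧ b₁ ψ ≠ 0 ∧ u₀ ψ ≠ 0 by
      obtain ⟨d, hd, hp⟩ := hp
      apply ne_zero_three
      rw [ha₀, hb₁, hu₀, ← charsum_sumset' ψ i010, charsum_eq_neg_of_near hd hp hψ]
      exact neg_ne_zero.2 (addChar_ne_zero ψ d)
  have N001 := fun (hp : ∃ d, d ∉ ((S₀ ×ˢ T₀ ×ˢ U₁).image fun p : A × A × A => p.1 + p.2.1 + p.2.2) ∧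
      (insert d ((S₀ ×ˢ T₀ ×ˢ U₁).image fun p : A × A × A => p.1 + p.2.1 + p.2.2)).image (fun x => x + c₀) =
        insert d ((S₀ ×ˢ T₀ ×ˢ U₁).image fun p : A × A × A => p.1 + p.2.1 + p.2.2))
      (ψ : AddChar A ℂ) (hψ : ψ c₀ = -1) =>
    show a₀ ψ ≠ 0 ∧ b₀ ψ ≠ 0 ∧ u₁ ψ ≠ 0 by
      obtain ⟨d, hd, hp⟩ := hp
      apply ne_zero_three
      rw [ha₀, hb₀, hu₁, ← charsum_sumset' ψ i001, charsum_eq_neg_of_near hd hp hψ]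
      exact neg_ne_zero.2 (addChar_ne_zero ψ d)
  have N011 := fun (hp : ∃ d, d ∉ ((S₀ ×ˢ T₁ ×ˢ U₁).image fun p : A × A × A => p.1 + p.2.1 + p.2.2) ∧
      (insert d ((S₀ ×ˢ T₁ ×ˢ U₁).image fun p : A × A × A => p.1 + p.2.1 + p.2.2)).image (fun x => x + c₀) =
        insert d ((S₀ ×ˢ T₁ ×ˢ U₁).image fun p : A × A × A => p.1 + p.2.1 + p.2.2))
      (ψ : AddChar A ℂ) (hψ : ψ c₀ = -1) =>
    show a₀ ψ ≠ 0 ∧ b₁ ψ ≠ 0 ∧ u₁ ψ ≠ 0 by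
      obtain ⟨d, hd, hp⟩ := hp
      apply ne_zero_three
      rw [ha₀, hb₁, hu₁, ← charsum_sumset' ψ i011, charsum_eq_neg_of_near hd hp hψ]
      exact neg_ne_zero.2 (addChar_ne_zero ψ d)
  have N101 := fun (hp : ∃ d, d ∉ ((S₁ ×ˢ T₀ ×ˢ U₁).image fun p : A × A × A => p.1 + p.2.1 + p.2.2) ∧
      (insert d ((S₁ ×ˢ T₀ ×ˢ U₁).image fun p : A × A × A => p.1 + p.2.1 + p.2.2)).image (fun x => x + c₀) =
        insert d ((S₁ ×ˢ T₀ ×ˢ U₁).image fun p : A × A × A => p.1 + p.2.1 + p.2.2))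
      (ψ : AddChar A ℂ) (hψ : ψ c₀ = -1) =>
    show a₁ ψ ≠ 0 ∧ b₀ ψ ≠ 0 ∧ u₁ ψ ≠ 0 by
      obtain ⟨d, hd, hp⟩ := hp
      apply ne_zero_three
      rw [ha₁, hb₀, hu₁, ← charsum_sumset' ψ i101, charsum_eq_neg_of_near hd hp hψ]
      exact neg_ne_zero.2 (addChar_ne_zero ψ d)
  have N110 := fun (hp : ∃ d, d ∉ ((S₁ ×ˢ T₁ ×ˢ U₀).image fun p : A × A × A => p.1 + p.2.1 + p.2.2) ∧
      (insert d ((S₁ ×ˢ T₁ ×ˢ U₀).image fun p : A × A × A => p.1 + p.2.1 + p.2.2)).image (fun x => x + c₀) =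
        insert d ((S₁ ×ˢ T₁ ×ˢ U₀).image fun p : A × A × A => p.1 + p.2.1 + p.2.2))
      (ψ : AddChar A ℂ) (hψ : ψ c₀ = -1) =>
    show a₁ ψ ≠ 0 ∧ b₁ ψ ≠ 0 ∧ u₀ ψ ≠ 0 by
      obtain ⟨d, hd, hp⟩ := hp
      apply ne_zero_three
      rw [ha₁, hb₁, hu₀, ← charsum_sumset' ψ i110, charsum_eq_neg_of_near hd hp hψ]
      exact neg_ne_zero.2 (addChar_ne_zero ψ d)
  -- vanishing at all odd characters ⇒ periodic
  have PS₀ := fun (h : ∀ ψ : AddChar A ℂ, ψ c₀ = -1 → a₀ ψ = 0) =>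
    periodic_of_charsum_eq_zero h2 (X := S₀) fun ψ hψ => by rw [← ha₀]; exact h ψ hψ
  have PS₁ := fun (h : ∀ ψ : AddChar A ℂ, ψ c₀ = -1 → a₁ ψ = 0) =>
    periodic_of_charsum_eq_zero h2 (X := S₁) fun ψ hψ => by rw [← ha₁]; exact h ψ hψ
  have PT₀ := fun (h : ∀ ψ : AddChar A ℂ, ψ c₀ = -1 → b₀ ψ = 0) =>
    periodic_of_charsum_eq_zero h2 (X := T₀) fun ψ hψ => by rw [← hb₀]; exact h ψ hψ
  have PT₁ := fun (h : ∀ ψ : AddChar A ℂ, ψ c₀ = -1 → b₁ ψ = 0) =>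
    periodic_of_charsum_eq_zero h2 (X := T₁) fun ψ hψ => by rw [← hb₁]; exact h ψ hψ
  have PU₀ := fun (h : ∀ ψ : AddChar A ℂ, ψ c₀ = -1 → u₀ ψ = 0) =>
    periodic_of_charsum_eq_zero h2 (X := U₀) fun ψ hψ => by rw [← hu₀]; exact h ψ hψ
  have PU₁ := fun (h : ∀ ψ : AddChar A ℂ, ψ c₀ = -1 → u₁ ψ = 0) =>
    periodic_of_charsum_eq_zero h2 (X := U₁) fun ψ hψ => by rw [← hu₁]; exact h ψ hψ
  -- an odd character exists (`c₀ ≠ 0`), used in the three complementary cases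
  obtain ⟨ψ₀, hψ₀⟩ : ∃ ψ : AddChar A ℂ, ψ c₀ = -1 := by
    by_contra hall
    push Not at hall
    have hper : ({(0 : A)} : Finset A).image (fun x => x + c₀) = {0} :=
      periodic_of_charsum_eq_zero h2 fun ψ hψ => absurd hψ (hall ψ)
    rw [image_singleton, zero_add, singleton_inj] at hper
    exact hc hper
  rcases h1 with ⟨q100, q010, q001⟩ | ⟨n100, q010, q001⟩ | ⟨q100, n010, q001⟩ | ⟨q100, q010, n001⟩ <;>
    rcases h3 with ⟨q011, q101, q110⟩ | ⟨n011, q101, q110⟩ | ⟨q011, n101, q110⟩ | ⟨q011, q101, n110⟩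
  · exact hnot ⟨q100, q010, q001, q011, q101, q110⟩
  · exact not_injOn_of_periodic₂₃ hc
      (PT₀ fun ψ hψ => zero_of_mul₂ (F001 q001 ψ hψ) (N011 n011 ψ hψ).1 (N011 n011 ψ hψ).2.2)
      (PU₀ fun ψ hψ => zero_of_mul₃ (F010 q010 ψ hψ) (N011 n011 ψ hψ).1 (N011 n011 ψ hψ).2.1)
      hS₀ hT₀ hU₀ i000
  · exact not_injOn_of_periodic₁₃ hc
      (PS₀ fun ψ hψ => zero_of_mul₁ (F001 q001 ψ hψ) (N101 n101 ψ hψ).2.1 (N101 n101 ψ hψ).2.2)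
      (PU₀ fun ψ hψ => zero_of_mul₃ (F100 q100 ψ hψ) (N101 n101 ψ hψ).1 (N101 n101 ψ hψ).2.1)
      hS₀ hT₀ hU₀ i000
  · exact not_injOn_of_periodic₁₂ hc
      (PS₀ fun ψ hψ => zero_of_mul₁ (F010 q010 ψ hψ) (N110 n110 ψ hψ).2.1 (N110 n110 ψ hψ).2.2)
      (PT₀ fun ψ hψ => zero_of_mul₂ (F100 q100 ψ hψ) (N110 n110 ψ hψ).1 (N110 n110 ψ hψ).2.2)
      hS₀ hT₀ hU₀ i000
  · exact not_injOn_of_periodic₂₃ hc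
      (PT₁ fun ψ hψ => zero_of_mul₂ (F110 q110 ψ hψ) (N100 n100 ψ hψ).1 (N100 n100 ψ hψ).2.2)
      (PU₁ fun ψ hψ => zero_of_mul₃ (F101 q101 ψ hψ) (N100 n100 ψ hψ).1 (N100 n100 ψ hψ).2.1)
      hS₁ hT₁ hU₁ i111
  · exact mul_ne_zero (mul_ne_zero (N011 n011 ψ₀ hψ₀).1 (N011 n011 ψ₀ hψ₀).2.1) (N100 n100 ψ₀ hψ₀).2.2
      (F010 q010 ψ₀ hψ₀)
  · exact not_injOn_of_periodic₁₂ hc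
      (PS₀ fun ψ hψ => zero_of_mul₁ (F001 q001 ψ hψ) (N101 n101 ψ hψ).2.1 (N101 n101 ψ hψ).2.2)
      (PT₁ fun ψ hψ => zero_of_mul₂ (F110 q110 ψ hψ) (N100 n100 ψ hψ).1 (N100 n100 ψ hψ).2.2)
      hS₀ hT₁ hU₀ i010
  · exact not_injOn_of_periodic₁₃ hc
      (PS₀ fun ψ hψ => zero_of_mul₁ (F010 q010 ψ hψ) (N110 n110 ψ hψ).2.1 (N100 n100 ψ hψ).2.2)
      (PU₁ fun ψ hψ => zero_of_mul₃ (F101 q101 ψ hψ) (N100 n100 ψ hψ).1 (N100 n100 ψ hψ).2.1)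
      hS₀ hT₀ hU₁ i001
  · exact not_injOn_of_periodic₁₃ hc
      (PS₁ fun ψ hψ => zero_of_mul₁ (F110 q110 ψ hψ) (N010 n010 ψ hψ).2.1 (N010 n010 ψ hψ).2.2)
      (PU₁ fun ψ hψ => zero_of_mul₃ (F011 q011 ψ hψ) (N010 n010 ψ hψ).1 (N010 n010 ψ hψ).2.1)
      hS₁ hT₁ hU₁ i111
  · exact not_injOn_of_periodic₁₂ hc
      (PS₁ fun ψ hψ => zero_of_mul₁ (F110 q110 ψ hψ) (N011 n011 ψ hψ).2.1 (N010 n010 ψ hψ).2.2)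
      (PT₀ fun ψ hψ => zero_of_mul₂ (F001 q001 ψ hψ) (N011 n011 ψ hψ).1 (N011 n011 ψ hψ).2.2)
      hS₁ hT₀ hU₀ i100
  · exact mul_ne_zero (mul_ne_zero (N101 n101 ψ₀ hψ₀).1 (N101 n101 ψ₀ hψ₀).2.1) (N010 n010 ψ₀ hψ₀).2.2
      (F100 q100 ψ₀ hψ₀)
  · exact not_injOn_of_periodic₂₃ hc
      (PT₀ fun ψ hψ => zero_of_mul₂ (F100 q100 ψ hψ) (N110 n110 ψ hψ).1 (N010 n010 ψ hψ).2.2)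
      (PU₁ fun ψ hψ => zero_of_mul₃ (F011 q011 ψ hψ) (N010 n010 ψ hψ).1 (N010 n010 ψ hψ).2.1)
      hS₀ hT₀ hU₁ i001
  · exact not_injOn_of_periodic₁₂ hc
      (PS₁ fun ψ hψ => zero_of_mul₁ (F101 q101 ψ hψ) (N001 n001 ψ hψ).2.1 (N001 n001 ψ hψ).2.2)
      (PT₁ fun ψ hψ => zero_of_mul₂ (F011 q011 ψ hψ) (N001 n001 ψ hψ).1 (N001 n001 ψ hψ).2.2)
      hS₁ hT₁ hU₁ i111
  · exact not_injOn_of_periodic₁₃ hc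
      (PS₁ fun ψ hψ => zero_of_mul₁ (F101 q101 ψ hψ) (N001 n001 ψ hψ).2.1 (N001 n001 ψ hψ).2.2)
      (PU₀ fun ψ hψ => zero_of_mul₃ (F010 q010 ψ hψ) (N001 n001 ψ hψ).1 (N011 n011 ψ hψ).2.1)
      hS₁ hT₀ hU₀ i100
  · exact not_injOn_of_periodic₂₃ hc
      (PT₁ fun ψ hψ => zero_of_mul₂ (F011 q011 ψ hψ) (N001 n001 ψ hψ).1 (N001 n001 ψ hψ).2.2)
      (PU₀ fun ψ hψ => zero_of_mul₃ (F100 q100 ψ hψ) (N101 n101 ψ hψ).1 (N101 n101 ψ hψ).2.1)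
      hS₁ hT₁ hU₀ i110
  · exact mul_ne_zero (mul_ne_zero (N110 n110 ψ₀ hψ₀).1 (N001 n001 ψ₀ hψ₀).2.1) (N110 n110 ψ₀ hψ₀).2.2
      (F100 q100 ψ₀ hψ₀)

end OddCharacters

end Summit.MatrixMultiplication.OmegaCensus
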